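import Literature.NumberTheory.EllipticCurves.KrizLi2019.EisensteinHeegnerLog
import Mathlib.NumberTheory.Padics.Hensel
import Mathlib.FieldTheory.Finite.Basic
import HarnessLib

/-!
# Existence of the Teichmüller character mod `p` as a `ℚ_p`-valued Dirichlet character

Topic `Literature/NumberTheory/EllipticCurves/KrizLi2019`; namespace
`Literature.NumberTheory.EllipticCurves.KrizLi2019`. THEOREMS ONLY (no definition, no named fact).

The named fact `thm120_padicLogHeegner_unit_of_bernoulli` (Kriz–Li, FMS 7 (2019), Thm. 1.20) and
its consumers (bsd-cm ROUTE U, `Summits/…/X12/O11/RouteU*`) take the mod-`p` Teichmüller character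
as a BINDER `ω : DirichletCharacter ℚ_[p] p` under the predicate `IsTeichmullerCharacter ω`
(`‖ω(a) − a‖_p < 1` for `p ∤ a`; Washington §5.1). This file proves that such an `ω` EXISTS, by
Hensel's lemma (Mathlib `hensels_lemma`) for `X^{p−1} − 1` at the integer representatives of the
units mod `p`: for `p ∤ n` there is a unique `z ∈ ℤ_p` with `z^{p−1} = 1` and `‖z − n‖ < 1`
(`exists_unique_pow_eq_one_norm_sub_lt`); uniqueness makes `n ↦ z` multiplicative and well
defined mod `p`, and `MulChar.ofUnitHom` packages it (`exists_isTeichmullerCharacter`).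
References: Washington, *Introduction to Cyclotomic Fields*, §5.1 (`ω(a) ≡ a mod p`,
`ω(a)^{p−1} = 1`); Serre, *Local Fields*, II §4 Prop. 8 (multiplicative representatives).
-/

noncomputable section

open scoped Classical
open Polynomial

namespace Literature.NumberTheory.EllipticCurves.KrizLi2019

variable {p : ℕ} [hp : Fact p.Prime]

/-- An integer not divisible by the prime `p` is coprime to `p` (private plumbing). [folklore] -/
private theorem isCoprime_of_not_dvd_teich (n : ℤ) (hn : ¬ (p : ℤ) ∣ n) : IsCoprime n (p : ℤ) :=
  (Int.isCoprime_iff_gcd_eq_one.mpr (by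
    rcases (Nat.dvd_prime hp.out).mp
        (show Int.gcd n p ∣ p by exact_mod_cast Int.gcd_dvd_right n p) with h | h
    · exact h
    · exfalso; apply hn
      have h3 : (Int.gcd n p : ℤ) ∣ n := Int.gcd_dvd_left n p
      rw [h] at h3; exact h3))

/-- **Teichmüller representatives by Hensel's lemma**: for an integer `n` prime to `p` there is a
unique `z ∈ ℤ_p` with `z^{p−1} = 1` and `z ≡ n (mod p)`. (`F = X^{p−1} − 1`, `‖F(n)‖ < 1` by
Fermat, `‖F′(n)‖ = ‖(p−1)n^{p−2}‖ = 1`.) [cite: Washington1997, §5.1 (ω(a)^{p−1} = 1, ω(a) ≡ a mod p)] -/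
theorem exists_unique_pow_eq_one_norm_sub_lt (n : ℤ) (hn : ¬ (p : ℤ) ∣ n) :
    ∃ z : ℤ_[p], z ^ (p - 1) = 1 ∧ ‖z - (n : ℤ_[p])‖ < 1 ∧
      ∀ z' : ℤ_[p], z' ^ (p - 1) = 1 → ‖z' - (n : ℤ_[p])‖ < 1 → z' = z := by
  have hpp : p.Prime := hp.out
  have hcop : IsCoprime n (p : ℤ) := isCoprime_of_not_dvd_teich n hn
  -- the polynomial and the Hensel hypothesis
  set F : Polynomial ℤ_[p] := X ^ (p - 1) - C 1 with hF
  have hFa : ∀ w : ℤ_[p], F.aeval w = w ^ (p - 1) - 1 := by intro w; simp [hF]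
  have hF' : F.derivative = C ((p - 1 : ℕ) : ℤ_[p]) * X ^ (p - 2) := by
    rw [hF, derivative_sub, derivative_C, sub_zero, derivative_X_pow, C_eq_natCast]
    rcases Nat.exists_eq_add_of_le hpp.two_le with ⟨k, hk⟩
    subst hk
    simp
  have hn1 : ‖(n : ℤ_[p])‖ = 1 := by
    apply le_antisymm (PadicInt.norm_le_one _)
    by_contra hlt
    exact hn ((PadicInt.norm_int_lt_one_iff_dvd n).mp (not_le.mp hlt))
  have hpm1 : ‖((p - 1 : ℕ) : ℤ_[p])‖ = 1 := by
    apply le_antisymm (PadicInt.norm_le_one _)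
    by_contra hlt
    have h : (p : ℤ) ∣ ((p - 1 : ℕ) : ℤ) :=
      (PadicInt.norm_int_lt_one_iff_dvd ((p - 1 : ℕ) : ℤ)).mp (by simpa using not_le.mp hlt)
    have h' : (p : ℤ) ∣ (p : ℤ) - ((p - 1 : ℕ) : ℤ) := dvd_sub (dvd_refl _) h
    have h1 : (p : ℤ) - ((p - 1 : ℕ) : ℤ) = 1 := by
      rw [Nat.cast_sub hpp.one_le]; push_cast; ring
    rw [h1] at h'
    have : (p : ℤ) ≤ 1 := Int.le_of_dvd one_pos h'
    have : (1 : ℤ) < p := by exact_mod_cast hpp.one_lt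
    omega
  have hF'a : ∀ x : ℤ_[p], ‖x‖ = 1 → ‖F.derivative.aeval x‖ = 1 := by
    intro x hx
    rw [hF']
    simp [hpm1, hx]
  have hnorm : ‖F.aeval (n : ℤ_[p])‖ < ‖F.derivative.aeval (n : ℤ_[p])‖ ^ 2 := by
    rw [hF'a _ hn1, one_pow, hFa]
    have := (PadicInt.norm_int_lt_one_iff_dvd (n ^ (p - 1) - 1)).mpr
      (Int.prime_dvd_pow_sub_one hpp hcop)
    push_cast at this
    exact this
  obtain ⟨z, hz, hza, -, huniq⟩ := hensels_lemma hnorm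
  rw [hF'a _ hn1] at hza huniq
  have hroot : ∀ w : ℤ_[p], F.aeval w = 0 ↔ w ^ (p - 1) = 1 := by
    intro w; rw [hFa, sub_eq_zero]
  exact ⟨z, (hroot z).mp hz, hza, fun z' hz' hz'a => huniq z' ((hroot z').mpr hz') hz'a⟩

/-- **Existence of the Teichmüller character**: for every prime `p` there is a Dirichlet character
`ω` mod `p` with values in `ℚ_p` and `ω(a) ≡ a (mod p)` for all `a` prime to `p`
(`IsTeichmullerCharacter ω`), namely `a ↦` the `(p−1)`-st root of unity of `ℤ_p` congruent to `a`.
[cite: Washington1997, §5.1 (the Teichmüller character ω: ω(a) ≡ a mod p)] -/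
theorem exists_isTeichmullerCharacter :
    ∃ ω : DirichletCharacter ℚ_[p] p, IsTeichmullerCharacter ω := by
  have hpp : p.Prime := hp.out
  -- least residues of units are prime to `p`
  have hval : ∀ u : (ZMod p)ˣ, ¬ (p : ℤ) ∣ (((u : ZMod p).val : ℕ) : ℤ) := by
    intro u h
    have hc := ZMod.val_coe_unit_coprime u
    have hdvd : p ∣ (u : ZMod p).val := by exact_mod_cast h
    have : p ∣ Nat.gcd (u : ZMod p).val p := Nat.dvd_gcd hdvd (dvd_refl p)
    rw [hc] at this
    exact hpp.one_lt.ne' (Nat.dvd_one.mp this)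
  -- Teichmüller representative `z u` of the unit `u`, through its least residue
  choose z hz1 hz2 hzu using fun u : (ZMod p)ˣ =>
    exists_unique_pow_eq_one_norm_sub_lt (p := p) (((u : ZMod p).val : ℕ) : ℤ) (hval u)
  have hz0 : ∀ u, (z u : ℚ_[p]) ≠ 0 := by
    intro u h0
    have h00 : z u = 0 := PadicInt.coe_eq_zero.mp h0
    have h1 := hz1 u
    rw [h00, zero_pow (Nat.sub_ne_zero_of_lt hpp.one_lt)] at h1
    exact zero_ne_one h1
  -- congruent residues: `‖m − m'‖ < 1` when `m ≡ m' (mod p)` in `ZMod p`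
  have hcong : ∀ m m' : ℤ, (m : ZMod p) = (m' : ZMod p) → ‖(m : ℤ_[p]) - (m' : ℤ_[p])‖ < 1 := by
    intro m m' h
    have hd : (p : ℤ) ∣ m - m' := (ZMod.intCast_eq_intCast_iff_dvd_sub m' m p).mp h.symm
    have := (PadicInt.norm_int_lt_one_iff_dvd (m - m')).mpr hd
    push_cast at this
    exact this
  -- multiplicativity from uniqueness
  have hmul : ∀ u v : (ZMod p)ˣ, z (u * v) = z u * z v := by
    intro u v
    symm
    apply hzu (u * v)
    · rw [mul_pow, hz1, hz1, one_mul]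
    · set nu : ℤ_[p] := ((((u : ZMod p).val : ℕ) : ℤ) : ℤ_[p]) with hnu
      set nv : ℤ_[p] := ((((v : ZMod p).val : ℕ) : ℤ) : ℤ_[p]) with hnv
      set nuv : ℤ_[p] := (((((u * v : (ZMod p)ˣ) : ZMod p).val : ℕ) : ℤ) : ℤ_[p]) with hnuv
      have h1 : ‖z u * z v - nu * nv‖ < 1 := by
        have e : z u * z v - nu * nv = (z u - nu) * z v + nu * (z v - nv) := by ring
        rw [e]
        refine (PadicInt.nonarchimedean _ _).trans_lt (max_lt ?_ ?_)
        · rw [norm_mul]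
          calc ‖z u - nu‖ * ‖z v‖ ≤ ‖z u - nu‖ * 1 :=
                mul_le_mul_of_nonneg_left (PadicInt.norm_le_one _) (norm_nonneg _)
            _ < 1 := by rw [mul_one]; exact hz2 u
        · rw [norm_mul]
          calc ‖nu‖ * ‖z v - nv‖ ≤ 1 * ‖z v - nv‖ :=
                mul_le_mul_of_nonneg_right (PadicInt.norm_le_one _) (norm_nonneg _)
            _ < 1 := by rw [one_mul]; exact hz2 v
      have h2 : ‖nu * nv - nuv‖ < 1 := by
        have hc : (((((u : ZMod p).val : ℕ) : ℤ) * (((v : ZMod p).val : ℕ) : ℤ) : ℤ) : ZMod p) =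
            (((((u * v : (ZMod p)ˣ) : ZMod p).val : ℕ) : ℤ) : ZMod p) := by
          simp only [Int.cast_mul, Int.cast_natCast, ZMod.natCast_zmod_val, Units.val_mul]
        have := hcong _ _ hc
        rw [hnu, hnv, hnuv]
        push_cast at this ⊢
        exact this
      have e : z u * z v - nuv = (z u * z v - nu * nv) + (nu * nv - nuv) := by ring
      rw [e]
      exact (PadicInt.nonarchimedean _ _).trans_lt (max_lt h1 h2)
  have hone : z 1 = 1 := by
    symm
    apply hzu 1 (1 : ℤ_[p]) (one_pow _)
    rw [Units.val_one, ZMod.val_one]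
    simp
  -- the unit-valued hom and the character
  let f : (ZMod p)ˣ →* ℚ_[p]ˣ :=
    { toFun := fun u => Units.mk0 (z u : ℚ_[p]) (hz0 u)
      map_one' := by ext; simp [hone]
      map_mul' := fun u v => by ext; simp [hmul] }
  refine ⟨MulChar.ofUnitHom f, fun a ha => ?_⟩
  -- `a` is a unit mod `p`; `ω(a) = z u` where `u.val ≡ a (mod p)`
  have hne : (a : ZMod p) ≠ 0 := by
    rwa [Ne, ZMod.intCast_zmod_eq_zero_iff_dvd]
  set u : (ZMod p)ˣ := (Ne.isUnit hne).unit with hu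
  have huval : ((u : ZMod p)) = (a : ZMod p) := (Ne.isUnit hne).unit_spec
  have hωa : (MulChar.ofUnitHom f) (a : ZMod p) = (z u : ℚ_[p]) := by
    rw [← huval, MulChar.ofUnitHom_coe]
    rfl
  rw [hωa]
  have hres : ‖((((u : ZMod p).val : ℕ) : ℤ) : ℤ_[p]) - (a : ℤ_[p])‖ < 1 := by
    apply hcong
    simp only [Int.cast_natCast, ZMod.natCast_zmod_val]
    exact huval
  have hlt : ‖z u - (a : ℤ_[p])‖ < 1 := by
    have e : z u - (a : ℤ_[p]) =
        (z u - ((((u : ZMod p).val : ℕ) : ℤ) : ℤ_[p])) +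
          (((((u : ZMod p).val : ℕ) : ℤ) : ℤ_[p]) - (a : ℤ_[p])) := by ring
    rw [e]
    exact (PadicInt.nonarchimedean _ _).trans_lt (max_lt (hz2 u) hres)
  have hcoe : ((z u - (a : ℤ_[p]) : ℤ_[p]) : ℚ_[p]) = (z u : ℚ_[p]) - (a : ℚ_[p]) := by
    push_cast; rfl
  rw [← hcoe, ← PadicInt.norm_def]
  exact hlt

end Literature.NumberTheory.EllipticCurves.KrizLi2019

end
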